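import Summits.MatrixMultiplication.OmegaCensus.SmallFormats.MatMul22nRankGF7Slack5Search
import HarnessLib

/-!
# ω-census family (a): replay of the slack-5 search certificate, CHECK A part 7 of 12 (elements `168 ≤ h < 196`)

Cell `pub-omega` (unit `pub-omega-tensor-g16`), topic `Summits/MatrixMultiplication/OmegaCensus` (sub-folder `SmallFormats`).
Framing (verbatim): lottery ticket; floor = certified bounds/negative ranges. HONEST FRAMING: machine-generated kernel replay
(`pub-omega-tensor-g16/code/gen5_runs.py`): `levelsOK5n h = true` for the elements `168 ≤ h < 196` of `PGL₂(7)`: for every slot `(c, h)`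
(`c < 656`) and bucket level, if the key of its column is visited then the bucket holds an entry with that column (SIMD key planes,
`MatMul22nRankGF7Plane`). Meaning: `slotOK5_of_levelsOK5` (`MatMul22nRankGF7Slack5SearchSound`). Nothing here is progress on `ω`.
-/

namespace Summit.MatrixMultiplication.OmegaCensus.SmallFormats

set_option Elab.async false

set_option maxRecDepth 100000 in
set_option maxHeartbeats 400000000 in
/-- Elements `168 ≤ h < 172`. -/
theorem levelsOK5_ok_168_172 : ∀ h : Fin 336, 168 ≤ h.val → h.val < 172 → levelsOK5n h.val = true := by decide +kernel

set_option maxRecDepth 100000 in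
set_option maxHeartbeats 400000000 in
/-- Elements `172 ≤ h < 176`. -/
theorem levelsOK5_ok_172_176 : ∀ h : Fin 336, 172 ≤ h.val → h.val < 176 → levelsOK5n h.val = true := by decide +kernel

set_option maxRecDepth 100000 in
set_option maxHeartbeats 400000000 in
/-- Elements `176 ≤ h < 180`. -/
theorem levelsOK5_ok_176_180 : ∀ h : Fin 336, 176 ≤ h.val → h.val < 180 → levelsOK5n h.val = true := by decide +kernel

set_option maxRecDepth 100000 in
set_option maxHeartbeats 400000000 in
/-- Elements `180 ≤ h < 184`. -/
theorem levelsOK5_ok_180_184 : ∀ h : Fin 336, 180 ≤ h.val → h.val < 184 → levelsOK5n h.val = true := by decide +kernel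

set_option maxRecDepth 100000 in
set_option maxHeartbeats 400000000 in
/-- Elements `184 ≤ h < 188`. -/
theorem levelsOK5_ok_184_188 : ∀ h : Fin 336, 184 ≤ h.val → h.val < 188 → levelsOK5n h.val = true := by decide +kernel

set_option maxRecDepth 100000 in
set_option maxHeartbeats 400000000 in
/-- Elements `188 ≤ h < 192`. -/
theorem levelsOK5_ok_188_192 : ∀ h : Fin 336, 188 ≤ h.val → h.val < 192 → levelsOK5n h.val = true := by decide +kernel

set_option maxRecDepth 100000 in
set_option maxHeartbeats 400000000 in
/-- Elements `192 ≤ h < 196`. -/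
theorem levelsOK5_ok_192_196 : ∀ h : Fin 336, 192 ≤ h.val → h.val < 196 → levelsOK5n h.val = true := by decide +kernel

/-- CHECK A for the elements `168 ≤ h < 196`. -/
theorem levelsOK5_run_7 : ∀ h : Fin 336, 168 ≤ h.val → h.val < 196 → levelsOK5n h.val = true := by
  intro h hlo hhi
  by_cases h172 : h.val < 172
  · exact levelsOK5_ok_168_172 h (by omega) h172
  by_cases h176 : h.val < 176
  · exact levelsOK5_ok_172_176 h (by omega) h176
  by_cases h180 : h.val < 180
  · exact levelsOK5_ok_176_180 h (by omega) h180
  by_cases h184 : h.val < 184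
  · exact levelsOK5_ok_180_184 h (by omega) h184
  by_cases h188 : h.val < 188
  · exact levelsOK5_ok_184_188 h (by omega) h188
  by_cases h192 : h.val < 192
  · exact levelsOK5_ok_188_192 h (by omega) h192
  exact levelsOK5_ok_192_196 h (by omega) hhi

end Summit.MatrixMultiplication.OmegaCensus.SmallFormats
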